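import Literature.NumberTheory.Automorphic.ResiduallyUnipotentCyclicLattices   -- ★ p845460 (this seat): `rank_redMat_sub_one_eq_iff_exists_span_eq_span_range_pow_mulVec` (+ ★ `FixedCosetsStableLattices`, ★ `IntegralMatrixReduction`)
import Literature.NumberTheory.Automorphic.GLnResiduallyRegularConjugacy      -- ★ `GLn.charpoly_redMat_map_eq`
import HarnessLib

/-!
# Counting the residually REGULAR-unipotent fixed cosets: a DEEP `γ` is residually unipotent on every fixed coset, and
# `#{gK ∈ Fix_γ : rank(red(g⁻¹γg) − 1) = n − 1} = #{Λ = Λ(g) : γΛ = Λ, Λ = ⊕_{j<n} 𝒪·γ^j w}` (in `GL_n(F)`, in `U(J)`, and along any level-matching isomorphism)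

Topic `NumberTheory/Automorphic`; namespace `Literature.NumberTheory.Automorphic`.  THEOREMS ONLY (no definition, no instance, no notation, no named fact,
no `sorry`); generic `[Field F] [ValuativeRel F]`, any `n`.  Cell `pub/hodgecm-mathlib` (D-0151), crux H413 = `stmt-HodgeConjecture-24833`; road «S3-tree»
(LEAD F0P3a-plan (g11), architect A-p16 (g29) A-65 (1)), brick T3′ «depth-zero κ-transfer» (holder F0P3b-p01 (g11), DESIGN v1 419b4e54 §2 O8), organ **O8b
«THE FOUR VALUES OF g»** (A-p12 (g21)), FILE 2∕3: the stratum COUNTS that the generic value formula ★ `classOrbitalIntegral_eq_smul_sum_ncard_strata`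
(`OrbitalIntegralFixedPointStrata`) is fed with.  HONEST LABEL: HC_CM is proved only modulo the 2 remaining named inputs (hLiu418 24832, h413 24833) until
rung 0 closes; nothing printed is asserted here (linear algebra over a valuation ring + coset bookkeeping).

THE MATHEMATICS.  (§1) If the characteristic polynomial of `γ ∈ GL_n(F)` is congruent to `(X − 1)^n` modulo `𝔪` coefficientwise (a DEEP element: integral
eigenvalues `≡ 1`), then for every `g` with `k = g⁻¹γg ∈ GL_n(𝒪)` the reduction `k̄ − 1` is nilpotent (`p_k = p_γ`, ★ `GLn.charpoly_redMat_map_eq`, Cayley–Hamilton):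
the hypothesis `hu` of ★ `rank_redMat_sub_one_eq_iff_exists_span_eq_span_range_pow_mulVec` holds UNIFORMLY on `Fix_γ`.  (§2) The fixed-coset ↔ stable-lattice
bijection `gK ↦ Λ(g)` of ★ `FixedCosetsStableLattices` restricted by a predicate `P` on lattices: `#{gK ∈ Fix_γ : P(Λ(g))} = #{Λ = Λ(g) : γΛ = Λ ∧ P Λ}`; with
`P Λ :≡ ∃ w, Λ = ⊕_{j<n} 𝒪·γ^j w` and §1 + ★ p845460 this is THE `ψ_{n−1}`-COUNT `n_{n−1}(γ) = #{γ-stable lattices in the class of 𝒪ⁿ free of rank one over 𝒪[γ]}`.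
(§3) The same inside the unitary group `U = U(J) ≤ GL_n(E)`, `K_U = U ∩ GL_n(𝒪)` (★ `natCard_fixedBy_unitary_eq_ncard` refined).  (§4) Transport of a
stratum count along a group isomorphism `e : G ≃* G′` matching the levels (`g ∈ K ↔ e g ∈ K′`) for a label `Q′` invariant under `K′`-conjugation — the socket for
★ `localNonsplitEquiv` (CM place model → one-place matrix model).

* §1 **`isNilpotent_redMat_conj_sub_one_of_charpoly`**.
* §2 `ncard_fixedBy_glInt_sep_eq_ncard`, **`ncard_fixedBy_glInt_rank_eq_ncard_free`**.
* §3 `ncard_fixedBy_unitary_sep_eq_ncard`, **`ncard_fixedBy_unitary_rank_eq_ncard_free`**.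
* §4 `apply_inv_out_mul_mul_out_iff_of_conj_invariant`, **`ncard_fixedBy_sep_congr`**.

## References
* [Kottwitz1986] R. E. Kottwitz, *Base change for unit elements of Hecke algebras*, Compositio Math. 60 (1986): §3 (fixed cosets ↔ stable lattices).
* [HornJohnson2013] R. A. Horn, C. R. Johnson, *Matrix Analysis*, 2nd ed. (CUP 2013): Thm 2.4.3.2 (Cayley–Hamilton) p. 109; §3.2 Problem 3.2.P27 (b) p. 190.
* [Rogawski1990] J. D. Rogawski, *Automorphic Representations of Unitary Groups in Three Variables* (1990): §4.9 p. 54.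
* [Laumon1995] G. Laumon, *Cohomology of Drinfeld Modular Varieties* I (1996): Lemma (5.3.2) p. 136.
-/

set_option autoImplicit false

noncomputable section

open scoped ValuativeRel Matrix MatrixGroups Polynomial
open ValuativeRel Set

namespace Literature.NumberTheory.Automorphic

open Literature.NumberTheory.Automorphic.IntegralReduction

/-! ## §1 Deep elements are residually unipotent on every fixed coset -/

section Deep

variable {F : Type*} [Field F] [ValuativeRel F] {n : ℕ}

/-- **DEEP ⇒ RESIDUALLY UNIPOTENT ON EVERY FIXED COSET.**  If the characteristic polynomial of `γ ∈ GL_n(F)` is congruent to `(X − 1)^n` modulo `𝔪`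
coefficientwise (e.g. `γ` has integral eigenvalues `λ_i ≡ 1 (mod 𝔪)`), then for every `g` with `g⁻¹γg ∈ GL_n(𝒪)` the reduction `red(g⁻¹γg) − 1` is nilpotent
(`p_{g⁻¹γg} = p_γ`, reduce, Cayley–Hamilton). [cite: Kottwitz1986, §3] [cite: HornJohnson2013, Thm 2.4.3.2 (Cayley–Hamilton) p. 109] -/
theorem isNilpotent_redMat_conj_sub_one_of_charpoly (γ g : GL (Fin n) F) (hk : g⁻¹ * γ * g ∈ glInt n F)
    (hγ : ∀ m : ℕ, valuation F (((γ : Matrix (Fin n) (Fin n) F).charpoly - (Polynomial.X - 1) ^ n).coeff m) < 1) :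
    IsNilpotent (redMat ((g⁻¹ * γ * g : GL (Fin n) F) : Matrix (Fin n) (Fin n) F) - 1) := by
  -- `k = g⁻¹γg = K₀ ⊗ 1` with `K₀ ∈ GL_n(𝒪)`
  obtain ⟨K₀, hK₀⟩ := hk
  -- `p_k = p_γ`, and `p_{K₀} ⊗ F = p_k`
  have hchar : ((K₀ : Matrix (Fin n) (Fin n) 𝒪[F]).charpoly).map (𝒪[F]).subtype = (γ : Matrix (Fin n) (Fin n) F).charpoly := by
    rw [← Matrix.charpoly_map, ← RingHom.mapMatrix_apply]
    have h1 : (𝒪[F]).subtype.mapMatrix (K₀ : Matrix (Fin n) (Fin n) 𝒪[F]) = ((g⁻¹ * γ * g : GL (Fin n) F) : Matrix (Fin n) (Fin n) F) := by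
      rw [← hK₀]; rfl
    rw [h1, Units.val_mul, Units.val_mul, Matrix.coe_units_inv, Matrix.charpoly_units_conj']
  -- the reduction of `p_{K₀}` is `(X − 1)^n`
  have hred : ((K₀ : Matrix (Fin n) (Fin n) 𝒪[F]).charpoly).map (IsLocalRing.residue 𝒪[F]) = (Polynomial.X - 1) ^ n := by
    have hdiff : ((K₀ : Matrix (Fin n) (Fin n) 𝒪[F]).charpoly - (Polynomial.X - 1) ^ n).map (IsLocalRing.residue 𝒪[F]) = 0 := by
      ext m
      rw [Polynomial.coeff_map, Polynomial.coeff_zero, IsLocalRing.residue_eq_zero_iff, IsLocalRing.mem_maximalIdeal, mem_nonunits_iff,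
        Valuation.Integer.not_isUnit_iff_valuation_lt_one]
      have h := hγ m
      rw [← hchar, ← Polynomial.map_X (𝒪[F]).subtype, ← Polynomial.map_one (𝒪[F]).subtype, ← Polynomial.map_sub, ← Polynomial.map_pow,
        ← Polynomial.map_sub, Polynomial.coeff_map] at h
      exact h
    rw [Polynomial.map_sub, sub_eq_zero, Polynomial.map_pow, Polynomial.map_sub, Polynomial.map_X, Polynomial.map_one] at hdiff
    exact hdiff
  -- Cayley–Hamilton for the reduction
  have hCH := Matrix.aeval_self_charpoly (redMat ((g⁻¹ * γ * g : GL (Fin n) F) : Matrix (Fin n) (Fin n) F))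
  have hk' : ((g⁻¹ * γ * g : GL (Fin n) F) : Matrix (Fin n) (Fin n) F) = ((Matrix.GeneralLinearGroup.map (𝒪[F]).subtype K₀ : GL (Fin n) F) : Matrix (Fin n) (Fin n) F) := by
    rw [hK₀]
  rw [hk', GLn.charpoly_redMat_map_eq, hred, map_pow, map_sub, Polynomial.aeval_X, map_one] at hCH
  rw [hk']
  exact ⟨n, hCH⟩

end Deep

/-! ## §2 `GL_n(F) ⊃ GL_n(𝒪)`: fixed cosets with a predicate ↔ stable lattices with a predicate -/

section GLn

variable {F : Type*} [Field F] [ValuativeRel F] {n : ℕ}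

/-- **THE FIXED-COSET ↔ STABLE-LATTICE BIJECTION WITH A PREDICATE** (★ `natCard_fixedBy_glInt_eq_ncard` refined): for any predicate `P` on lattices,
`#{gK ∈ Fix_γ(GL_n(F) ⧸ GL_n(𝒪)) : P(Λ(g))} = #{Λ = Λ(g) : γΛ = Λ ∧ P Λ}` (`Λ(out q)` does not depend on the representative, ★ `span_range_transpose_out_eq`).
[cite: Kottwitz1986, §3] [cite: Laumon1995, Lemma (5.3.2) p. 136] -/
theorem ncard_fixedBy_glInt_sep_eq_ncard (γ : GL (Fin n) F) (P : Submodule 𝒪[F] (Fin n → F) → Prop) :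
    {q : GL (Fin n) F ⧸ glInt n F | q ∈ MulAction.fixedBy (GL (Fin n) F ⧸ glInt n F) γ ∧
        P (Submodule.span 𝒪[F] (Set.range (((q.out : GL (Fin n) F) : Matrix (Fin n) (Fin n) F))ᵀ))}.ncard =
      {Λ : Submodule 𝒪[F] (Fin n → F) |
        (∃ g : GL (Fin n) F, Λ = Submodule.span 𝒪[F] (Set.range ((g : Matrix (Fin n) (Fin n) F))ᵀ)) ∧
          Λ.map ((Matrix.toLin' (γ : Matrix (Fin n) (Fin n) F)).restrictScalars 𝒪[F]) = Λ ∧ P Λ}.ncard := by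
  classical
  set Φ : GL (Fin n) F ⧸ glInt n F → Submodule 𝒪[F] (Fin n → F) := fun q =>
    Submodule.span 𝒪[F] (Set.range (((q.out : GL (Fin n) F) : Matrix (Fin n) (Fin n) F))ᵀ) with hΦ
  rw [← (injOn_span_out_glInt {q : GL (Fin n) F ⧸ glInt n F | q ∈ MulAction.fixedBy (GL (Fin n) F ⧸ glInt n F) γ ∧ P (Φ q)}).ncard_image]
  congr 1
  ext Λ
  simp only [Set.mem_image, Set.mem_setOf_eq]
  constructor
  · rintro ⟨q, ⟨hq, hP⟩, rfl⟩
    induction q using QuotientGroup.induction_on with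
    | H g =>
      rw [hΦ] at hP
      dsimp only at hP
      rw [span_range_transpose_out_eq] at hP ⊢
      exact ⟨⟨g, rfl⟩, (map_span_range_transpose_eq_self_iff_smul_mk_eq γ g).2 hq, hP⟩
  · rintro ⟨⟨g, rfl⟩, hΛ, hP⟩
    refine ⟨(g : GL (Fin n) F ⧸ glInt n F), ⟨(map_span_range_transpose_eq_self_iff_smul_mk_eq γ g).1 hΛ, ?_⟩, span_range_transpose_out_eq g⟩
    rw [hΦ]
    dsimp only
    rw [span_range_transpose_out_eq]
    exact hP

/-- For a `γ`-fixed coset `q` of `GL_n(F) ⧸ GL_n(𝒪)`: `(out q)⁻¹ γ (out q) ∈ GL_n(𝒪)`. [cite: Kottwitz1986, §3] -/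
theorem out_inv_mul_mul_out_mem_glInt_of_mem_fixedBy (γ : GL (Fin n) F) {q : GL (Fin n) F ⧸ glInt n F}
    (hq : q ∈ MulAction.fixedBy (GL (Fin n) F ⧸ glInt n F) γ) : (q.out)⁻¹ * γ * q.out ∈ glInt n F :=
  (mem_fixedBy_quotient_mk_iff (glInt n F) γ q.out).1 (by rw [QuotientGroup.out_eq']; exact hq)

/-- **THE `ψ_{n−1}` STRATUM AS A LATTICE COUNT**: for a deep `γ` (§1's hypothesis),
`#{gK ∈ Fix_γ : rank(red(g⁻¹γg) − 1) = n − 1} = #{Λ = Λ(g) : γΛ = Λ ∧ ∃ w, Λ = ⊕_{j<n} 𝒪·γ^j w}` — the residually regular-unipotent fixed cosets are the `γ`-stable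
lattices in the class of `𝒪ⁿ` that are free of rank one over `𝒪[γ]`. [cite: Kottwitz1986, §3] [cite: Rogawski1990, §4.9 p. 54] [cite: HornJohnson2013, §3.2 Problem 3.2.P27 (b) p. 190] -/
theorem ncard_fixedBy_glInt_rank_eq_ncard_free (γ : GL (Fin n) F)
    (hγ : ∀ m : ℕ, valuation F (((γ : Matrix (Fin n) (Fin n) F).charpoly - (Polynomial.X - 1) ^ n).coeff m) < 1) :
    {q : GL (Fin n) F ⧸ glInt n F | q ∈ MulAction.fixedBy (GL (Fin n) F ⧸ glInt n F) γ ∧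
        (redMat (((q.out)⁻¹ * γ * q.out : GL (Fin n) F) : Matrix (Fin n) (Fin n) F) - 1).rank = n - 1}.ncard =
      {Λ : Submodule 𝒪[F] (Fin n → F) |
        (∃ g : GL (Fin n) F, Λ = Submodule.span 𝒪[F] (Set.range ((g : Matrix (Fin n) (Fin n) F))ᵀ)) ∧
          Λ.map ((Matrix.toLin' (γ : Matrix (Fin n) (Fin n) F)).restrictScalars 𝒪[F]) = Λ ∧
            ∃ w : Fin n → F, Λ = Submodule.span 𝒪[F] (Set.range fun j : Fin n => ((γ : Matrix (Fin n) (Fin n) F) ^ (j : ℕ)) *ᵥ w)}.ncard := by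
  rw [← ncard_fixedBy_glInt_sep_eq_ncard γ (fun Λ => ∃ w : Fin n → F,
    Λ = Submodule.span 𝒪[F] (Set.range fun j : Fin n => ((γ : Matrix (Fin n) (Fin n) F) ^ (j : ℕ)) *ᵥ w))]
  congr 1
  ext q
  simp only [Set.mem_setOf_eq]
  refine ⟨fun ⟨hq, hr⟩ => ⟨hq, ?_⟩, fun ⟨hq, hP⟩ => ⟨hq, ?_⟩⟩
  · have hk := out_inv_mul_mul_out_mem_glInt_of_mem_fixedBy γ hq
    exact (rank_redMat_sub_one_eq_iff_exists_span_eq_span_range_pow_mulVec γ _ hk (isNilpotent_redMat_conj_sub_one_of_charpoly γ _ hk hγ)).1 hr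
  · have hk := out_inv_mul_mul_out_mem_glInt_of_mem_fixedBy γ hq
    exact (rank_redMat_sub_one_eq_iff_exists_span_eq_span_range_pow_mulVec γ _ hk (isNilpotent_redMat_conj_sub_one_of_charpoly γ _ hk hγ)).2 hP

end GLn

/-! ## §3 The unitary group `U(J) ≤ GL_n(E)`, `K_U = U ∩ GL_n(𝒪)` -/

section Unitary

variable {E : Type*} [Field E] [ValuativeRel E] {n : ℕ} (σ : E →+* E) (J : GL (Fin n) E)

/-- For a `γ`-fixed coset `q` of `U ⧸ K_U`: `(out q)⁻¹ γ (out q) ∈ GL_n(𝒪)` (as an element of `GL_n(E)`). [cite: Kottwitz1986, §3] -/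
theorem coe_out_inv_mul_mul_out_mem_glInt_of_mem_fixedBy (γ : ↥(unitaryGroupOfForm σ (J : Matrix (Fin n) (Fin n) E)))
    {q : ↥(unitaryGroupOfForm σ (J : Matrix (Fin n) (Fin n) E)) ⧸ (glInt n E).subgroupOf (unitaryGroupOfForm σ (J : Matrix (Fin n) (Fin n) E))}
    (hq : q ∈ MulAction.fixedBy (↥(unitaryGroupOfForm σ (J : Matrix (Fin n) (Fin n) E)) ⧸ (glInt n E).subgroupOf (unitaryGroupOfForm σ (J : Matrix (Fin n) (Fin n) E))) γ) :
    (((q.out)⁻¹ * γ * q.out : ↥(unitaryGroupOfForm σ (J : Matrix (Fin n) (Fin n) E))) : GL (Fin n) E) ∈ glInt n E :=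
  (Subgroup.mem_subgroupOf).1 ((mem_fixedBy_quotient_mk_iff ((glInt n E).subgroupOf (unitaryGroupOfForm σ (J : Matrix (Fin n) (Fin n) E))) γ q.out).1
    (by rw [QuotientGroup.out_eq']; exact hq))

/-- **THE FIXED-COSET ↔ STABLE-LATTICE BIJECTION WITH A PREDICATE, inside `U(J)`** (★ `natCard_fixedBy_unitary_eq_ncard` refined): for any predicate `P`,
`#{uK_U ∈ Fix_γ(U ⧸ K_U) : P(Λ(u))} = #{Λ = Λ(u), u ∈ U : γΛ = Λ ∧ P Λ}`. [cite: Kottwitz1986, §3] [cite: Rogawski1990, §4.9 p. 54] -/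
theorem ncard_fixedBy_unitary_sep_eq_ncard (γ : ↥(unitaryGroupOfForm σ (J : Matrix (Fin n) (Fin n) E))) (P : Submodule 𝒪[E] (Fin n → E) → Prop) :
    {q : ↥(unitaryGroupOfForm σ (J : Matrix (Fin n) (Fin n) E)) ⧸ (glInt n E).subgroupOf (unitaryGroupOfForm σ (J : Matrix (Fin n) (Fin n) E)) |
        q ∈ MulAction.fixedBy (↥(unitaryGroupOfForm σ (J : Matrix (Fin n) (Fin n) E)) ⧸ (glInt n E).subgroupOf (unitaryGroupOfForm σ (J : Matrix (Fin n) (Fin n) E))) γ ∧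
          P (Submodule.span 𝒪[E] (Set.range ((((q.out : ↥(unitaryGroupOfForm σ (J : Matrix (Fin n) (Fin n) E))) : GL (Fin n) E) :
            Matrix (Fin n) (Fin n) E))ᵀ))}.ncard =
      {Λ : Submodule 𝒪[E] (Fin n → E) |
        (∃ u ∈ unitaryGroupOfForm σ (J : Matrix (Fin n) (Fin n) E), Λ = Submodule.span 𝒪[E] (Set.range ((u : Matrix (Fin n) (Fin n) E))ᵀ)) ∧
          Λ.map ((Matrix.toLin' (((γ : GL (Fin n) E) : Matrix (Fin n) (Fin n) E))).restrictScalars 𝒪[E]) = Λ ∧ P Λ}.ncard := by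
  classical
  -- the map `q ↦ Λ(out q)` on `U ⧸ K_U`
  set Φ : ↥(unitaryGroupOfForm σ (J : Matrix (Fin n) (Fin n) E)) ⧸ (glInt n E).subgroupOf (unitaryGroupOfForm σ (J : Matrix (Fin n) (Fin n) E)) →
      Submodule 𝒪[E] (Fin n → E) := fun q =>
    Submodule.span 𝒪[E] (Set.range ((((q.out : ↥(unitaryGroupOfForm σ (J : Matrix (Fin n) (Fin n) E))) : GL (Fin n) E) :
      Matrix (Fin n) (Fin n) E))ᵀ) with hΦ
  -- `Λ(out (u K_U)) = Λ(u)`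
  have hout : ∀ u : ↥(unitaryGroupOfForm σ (J : Matrix (Fin n) (Fin n) E)),
      Φ (u : ↥(unitaryGroupOfForm σ (J : Matrix (Fin n) (Fin n) E)) ⧸ (glInt n E).subgroupOf (unitaryGroupOfForm σ (J : Matrix (Fin n) (Fin n) E))) =
        Submodule.span 𝒪[E] (Set.range ((((u : GL (Fin n) E)) : Matrix (Fin n) (Fin n) E))ᵀ) := by
    intro u
    obtain ⟨k, hk⟩ := QuotientGroup.mk_out_eq_mul ((glInt n E).subgroupOf (unitaryGroupOfForm σ (J : Matrix (Fin n) (Fin n) E))) u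
    rw [hΦ]
    simp only []
    rw [hk, Subgroup.coe_mul, eq_comm, span_range_transpose_eq_iff, inv_mul_cancel_left]
    exact (Subgroup.mem_subgroupOf).1 k.2
  have hinj : Set.InjOn Φ {q | q ∈ MulAction.fixedBy (↥(unitaryGroupOfForm σ (J : Matrix (Fin n) (Fin n) E)) ⧸ (glInt n E).subgroupOf (unitaryGroupOfForm σ (J : Matrix (Fin n) (Fin n) E))) γ ∧ P (Φ q)} := by
    intro q _ q' _ h
    have h' := (span_range_transpose_eq_iff
      ((q.out : ↥(unitaryGroupOfForm σ (J : Matrix (Fin n) (Fin n) E))) : GL (Fin n) E)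
      ((q'.out : ↥(unitaryGroupOfForm σ (J : Matrix (Fin n) (Fin n) E))) : GL (Fin n) E)).1 h
    rw [← Quotient.out_eq q, ← Quotient.out_eq q']
    refine QuotientGroup.eq.2 ((Subgroup.mem_subgroupOf).2 ?_)
    rw [Subgroup.coe_mul, Subgroup.coe_inv]
    exact h'
  rw [← hinj.ncard_image]
  congr 1
  ext Λ
  simp only [Set.mem_image, Set.mem_setOf_eq]
  constructor
  · rintro ⟨q, ⟨hq, hP⟩, rfl⟩
    induction q using QuotientGroup.induction_on with
    | H u =>
      rw [hout u] at hP ⊢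
      exact ⟨⟨u, u.2, rfl⟩, (map_span_range_transpose_eq_self_iff_smul_mk_eq_unitary σ J γ u).2 hq, hP⟩
  · rintro ⟨⟨u, hu, rfl⟩, hΛ, hP⟩
    refine ⟨((⟨u, hu⟩ : ↥(unitaryGroupOfForm σ (J : Matrix (Fin n) (Fin n) E))) :
        ↥(unitaryGroupOfForm σ (J : Matrix (Fin n) (Fin n) E)) ⧸ (glInt n E).subgroupOf (unitaryGroupOfForm σ (J : Matrix (Fin n) (Fin n) E))),
      ⟨(map_span_range_transpose_eq_self_iff_smul_mk_eq_unitary σ J γ ⟨u, hu⟩).1 hΛ, ?_⟩, hout ⟨u, hu⟩⟩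
    rw [hout ⟨u, hu⟩]
    exact hP

/-- **THE `ψ_{n−1}` STRATUM INSIDE `U(J)` AS A LATTICE COUNT**: for a deep `γ ∈ U` (§1's hypothesis on `p_γ`),
`#{uK_U ∈ Fix_γ(U ⧸ K_U) : rank(red(u⁻¹γu) − 1) = n − 1} = #{Λ = Λ(u), u ∈ U : γΛ = Λ ∧ ∃ w, Λ = ⊕_{j<n} 𝒪·γ^j w}` — DESIGN v1 §2 O8a's left-hand side.
[cite: Kottwitz1986, §3] [cite: Rogawski1990, §4.9 Prop. 4.9.1 (b) p. 55] -/
theorem ncard_fixedBy_unitary_rank_eq_ncard_free (γ : ↥(unitaryGroupOfForm σ (J : Matrix (Fin n) (Fin n) E)))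
    (hγ : ∀ m : ℕ, valuation E (((((γ : GL (Fin n) E)) : Matrix (Fin n) (Fin n) E).charpoly - (Polynomial.X - 1) ^ n).coeff m) < 1) :
    {q : ↥(unitaryGroupOfForm σ (J : Matrix (Fin n) (Fin n) E)) ⧸ (glInt n E).subgroupOf (unitaryGroupOfForm σ (J : Matrix (Fin n) (Fin n) E)) |
        q ∈ MulAction.fixedBy (↥(unitaryGroupOfForm σ (J : Matrix (Fin n) (Fin n) E)) ⧸ (glInt n E).subgroupOf (unitaryGroupOfForm σ (J : Matrix (Fin n) (Fin n) E))) γ ∧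
          (redMat ((((q.out)⁻¹ * γ * q.out : ↥(unitaryGroupOfForm σ (J : Matrix (Fin n) (Fin n) E))) : GL (Fin n) E) : Matrix (Fin n) (Fin n) E) - 1).rank = n - 1}.ncard =
      {Λ : Submodule 𝒪[E] (Fin n → E) |
        (∃ u ∈ unitaryGroupOfForm σ (J : Matrix (Fin n) (Fin n) E), Λ = Submodule.span 𝒪[E] (Set.range ((u : Matrix (Fin n) (Fin n) E))ᵀ)) ∧
          Λ.map ((Matrix.toLin' (((γ : GL (Fin n) E) : Matrix (Fin n) (Fin n) E))).restrictScalars 𝒪[E]) = Λ ∧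
            ∃ w : Fin n → E, Λ = Submodule.span 𝒪[E] (Set.range fun j : Fin n => ((((γ : GL (Fin n) E)) : Matrix (Fin n) (Fin n) E) ^ (j : ℕ)) *ᵥ w)}.ncard := by
  rw [← ncard_fixedBy_unitary_sep_eq_ncard σ J γ (fun Λ => ∃ w : Fin n → E,
    Λ = Submodule.span 𝒪[E] (Set.range fun j : Fin n => ((((γ : GL (Fin n) E)) : Matrix (Fin n) (Fin n) E) ^ (j : ℕ)) *ᵥ w))]
  congr 1
  ext q
  simp only [Set.mem_setOf_eq]
  refine ⟨fun ⟨hq, hr⟩ => ⟨hq, ?_⟩, fun ⟨hq, hP⟩ => ⟨hq, ?_⟩⟩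
  · have hk := coe_out_inv_mul_mul_out_mem_glInt_of_mem_fixedBy σ J γ hq
    rw [Subgroup.coe_mul, Subgroup.coe_mul, Subgroup.coe_inv] at hk hr
    exact (rank_redMat_sub_one_eq_iff_exists_span_eq_span_range_pow_mulVec (γ : GL (Fin n) E) _ hk
      (isNilpotent_redMat_conj_sub_one_of_charpoly (γ : GL (Fin n) E) _ hk hγ)).1 hr
  · have hk := coe_out_inv_mul_mul_out_mem_glInt_of_mem_fixedBy σ J γ hq
    rw [Subgroup.coe_mul, Subgroup.coe_mul, Subgroup.coe_inv] at hk ⊢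
    exact (rank_redMat_sub_one_eq_iff_exists_span_eq_span_range_pow_mulVec (γ : GL (Fin n) E) _ hk
      (isNilpotent_redMat_conj_sub_one_of_charpoly (γ : GL (Fin n) E) _ hk hγ)).2 hP

end Unitary

/-! ## §4 Transport of stratum counts along a level-matching isomorphism -/

section Congr

variable {G G' : Type*} [Group G] [Group G'] (K : Subgroup G) (K' : Subgroup G') (e : G ≃* G')

/-- A label invariant under `K`-conjugation reads the same on every representative: `Q((out gK)⁻¹ γ (out gK)) ↔ Q(g⁻¹ γ g)`. [cite: Kottwitz1986, §3] -/
theorem apply_inv_out_mul_mul_out_iff_of_conj_invariant (Q : G → Prop) (hQ : ∀ k ∈ K, ∀ x ∈ K, (Q (k⁻¹ * x * k) ↔ Q x)) (γ g : G)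
    (hg : g⁻¹ * γ * g ∈ K) : Q (((g : G ⧸ K)).out⁻¹ * γ * ((g : G ⧸ K)).out) ↔ Q (g⁻¹ * γ * g) := by
  obtain ⟨k, hk⟩ := QuotientGroup.mk_out_eq_mul K g
  rw [hk, show (g * (k : G))⁻¹ * γ * (g * k) = (k : G)⁻¹ * (g⁻¹ * γ * g) * k by group]
  exact hQ k k.2 _ hg

/-- **TRANSPORT OF A STRATUM COUNT along `e : G ≃* G′` with `g ∈ K ↔ e g ∈ K′`**: for labels `Q`, `Q′` with `Q x ↔ Q′ (e x)` and `Q′` invariant under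
`K′`-conjugation, `#{gK ∈ Fix_γ(G⧸K) : Q((out)⁻¹ γ (out))} = #{g′K′ ∈ Fix_{eγ}(G′⧸K′) : Q′((out)⁻¹ (eγ) (out))}` (the socket for ★ `localNonsplitEquiv`:
CM place model → one-place matrix model). [cite: Kottwitz1986, §3] -/
theorem ncard_fixedBy_sep_congr (hK : ∀ g : G, g ∈ K ↔ e g ∈ K') (γ : G) (Q : G → Prop) (Q' : G' → Prop)
    (hQ : ∀ x, Q x ↔ Q' (e x)) (hQ' : ∀ k' ∈ K', ∀ x ∈ K', (Q' (k'⁻¹ * x * k') ↔ Q' x)) :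
    {q : G ⧸ K | q ∈ MulAction.fixedBy (G ⧸ K) γ ∧ Q (q.out⁻¹ * γ * q.out)}.ncard =
      {q' : G' ⧸ K' | q' ∈ MulAction.fixedBy (G' ⧸ K') (e γ) ∧ Q' (q'.out⁻¹ * e γ * q'.out)}.ncard := by
  -- `Q` is `K`-conjugation invariant on `K` too
  have hQK : ∀ k ∈ K, ∀ x ∈ K, (Q (k⁻¹ * x * k) ↔ Q x) := by
    intro k hk x hx
    rw [hQ, hQ, map_mul, map_mul, map_inv]
    exact hQ' (e k) ((hK k).1 hk) (e x) ((hK x).1 hx)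
  -- the bijection of coset spaces
  let Ψ : G ⧸ K ≃ G' ⧸ K' :=
    Quotient.congr (e : G ≃ G') fun a b => by
      rw [QuotientGroup.leftRel_apply, QuotientGroup.leftRel_apply, hK, map_mul, map_inv]
      rfl
  have hΨ : ∀ g : G, Ψ (g : G ⧸ K) = (e g : G' ⧸ K') := fun g => Quotient.congr_mk _ _ g
  have key : ∀ q : G ⧸ K, q ∈ {q : G ⧸ K | q ∈ MulAction.fixedBy (G ⧸ K) γ ∧ Q (q.out⁻¹ * γ * q.out)} ↔
      Ψ q ∈ {q' : G' ⧸ K' | q' ∈ MulAction.fixedBy (G' ⧸ K') (e γ) ∧ Q' (q'.out⁻¹ * e γ * q'.out)} := by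
    intro q
    induction q using QuotientGroup.induction_on with
    | H g =>
      rw [Set.mem_setOf_eq, Set.mem_setOf_eq, hΨ, mem_fixedBy_quotient_mk_iff, mem_fixedBy_quotient_mk_iff]
      have hconj : e (g⁻¹ * γ * g) = (e g)⁻¹ * e γ * e g := by rw [map_mul, map_mul, map_inv]
      constructor
      · rintro ⟨hg, hQg⟩
        have hg' : (e g)⁻¹ * e γ * e g ∈ K' := by rw [← hconj]; exact (hK _).1 hg
        refine ⟨hg', ?_⟩
        rw [apply_inv_out_mul_mul_out_iff_of_conj_invariant K' Q' hQ' _ _ hg', ← hconj, ← hQ]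
        exact (apply_inv_out_mul_mul_out_iff_of_conj_invariant K Q hQK γ g hg).1 hQg
      · rintro ⟨hg', hQg⟩
        have hg : g⁻¹ * γ * g ∈ K := by rw [hK, hconj]; exact hg'
        refine ⟨hg, ?_⟩
        rw [apply_inv_out_mul_mul_out_iff_of_conj_invariant K Q hQK γ g hg, hQ, hconj]
        exact (apply_inv_out_mul_mul_out_iff_of_conj_invariant K' Q' hQ' _ _ hg').1 hQg
  rw [← Nat.card_coe_set_eq, ← Nat.card_coe_set_eq]
  exact Nat.card_congr (Ψ.subtypeEquiv key)

end Congr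

end Literature.NumberTheory.Automorphic

end
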